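import Summits.HodgeConjecture.HodgeConjecture.Theorems.WeilTypeLadderBlochSeed
import Literature.AlgebraicGeometry.HodgeTheory.BlochSemiregularSpreadOfSubscheme
import HarnessLib

/-!
# Venture HSemireg — the GENERAL local-complete-intersection door: a Bloch-semiregular lci SUBSCHEME (any components,
# any multiplicities) at ONE anchor, its class read through the tree's REAL fundamental class `subschemeClass`,
# ⟹ the local variational clause ⟹ the anchor's component

HONEST FRAMING. Lean index of the computation cell `pub-hsemireg`; nothing about any explicit variety is asserted; every
published input is a hypothesis BY NAME. Third cycle door of the cell, after `Transfer.lean` (D1: `Z` INTEGRAL, class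
pinned by support, fact `BlochSemiregularSpread`) and `UnionSeed.lean` (`Z` REDUCED with SMOOTH components, class
`Σ ι_{j*}1`, fact `BlochSemiregularSpreadSmoothComponents`): here `Z ↪ P` is ANY local complete intersection of
codimension `n` (singular components, multiplicities allowed — e.g. the Prong-C objects `T₁ ∪ ζT₁ ∪ ζ²T₁ ⊂ J(C)²`, images of
`W₂ × C` which need not be smooth), its class being Fulton's cycle `Σ mᵢ[Zᵢ]` read in Betti cohomology through the tree's
REAL `subschemeClass` (resolution cycle classes, complex orientations; literature seat lit-1,
`Literature/…/BlochSemiregularSpreadOfSubscheme.lean`), and the transport fact is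
`BlochSemiregularSpreadOfSubscheme (2n) n` — Bloch (7.4) / Buchweitz–Flenner Thm. 5.2 for an arbitrary lci subscheme, AS
PRINTED (refereed, named fact).

* `HasBlochSubschemeSeedAt n P h w` (PREDICATE): a projective-smoothness witness of `P` in dimension `2n`, a resolution
  family `ρ` in dimension `n`, a closed lci `i : Z ↪ P` of codimension `n` (pure: every point of the image of
  codimension `≥ n`; `Z` locally Noetherian; `[Z] ∈ Z_n(P)`), Bloch-semiregular, and rationals `q`, `μ ≠ 0` with
  `q·hⁿ + w = μ·[Z]`, `[Z] = subschemeClass … ρ i`.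
* `weilAnchorLocalClause_of_blochSpreadOfSubscheme_of_subschemeSeedAt` (PROVED): fact ∧ seed ⟹
  `WeilAnchorLocalClause n d P h w`, every `d`.
* `weilClasses_algebraic_of_similar_subschemeSeed`, `weilClasses_algebraic_split_of_hyperbolic_subschemeSeed`: the anchor's
  component / the split component from ONE such seed (reach facts BY NAME).

References: [Bloch1972Semiregularity] Thm. (7.4), Remark (7.5); [BuchweitzFlenner2003] Thm. 5.2; [Fulton1998] §1.5, §19.1;
[Deligne1982HodgeCycles] proof of Thm. 4.8.
-/

noncomputable section

open CategoryTheory CategoryTheory.Limits AlgebraicGeometry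
open Literature.AlgebraicTopology.SingularHomology

namespace Summit.Ventures.HSemireg

open Literature.AlgebraicGeometry Literature.AlgebraicGeometry.Motives
open Literature.AlgebraicGeometry.HodgeTheory
open Summit.HodgeConjecture.HodgeConjecture.WeilTypeLadder

/-- **A Bloch SUBSCHEME seed for `q·hⁿ + w` on the abelian `2n`-fold `P`** (PREDICATE, nothing asserted; design input):
`P` smooth projective of dimension `2n` (witness `hP`), a resolution family `ρ` of `P` in dimension `n` (choices of smooth
projective models of the `n`-dimensional closed subvarieties — they exist by Hironaka; the class below does not depend on
them for lci `Z`, Fulton's degree formula), a closed local complete intersection `i : Z ↪ P` of codimension `n`, pure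
(`n ≤ coheight z` on the image), `Z` locally Noetherian, with cycle `[Z] ∈ Z_n(P)`, BLOCH-SEMIREGULAR
(`IsBlochSemiregular i (2n) n`), and rationals `q`, `μ ≠ 0` with `q·hⁿ + w = μ·[Z]`, `[Z]` the tree's REAL fundamental
class `subschemeClass hP _ ρ i hi` (`Σᵢ mᵢ τᵢ_* 1`, complex orientations). Bloch's hypothesis of (7.4) in the form of
Remark (7.5) for an ARBITRARY lci. [cite: Bloch1972Semiregularity, Thm. (7.4) and Remark (7.5)]
[cite: Fulton1998, §1.5 and §19.1] -/
def HasBlochSubschemeSeedAt (n : ℕ) (P : AbelianVariety ℂ) (h : complexBetti P.X 2) (w : complexBetti P.X (2 * n)) :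
    Prop :=
  ∃ (hP : IsSmoothProjective (2 * n) P.X) (ρ : ResolutionFamily P.X n) (Z : Scheme.{0}) (i : Z ⟶ P.X.left)
    (hi : IsClosedImmersion i) (_ : IsLocallyNoetherian Z) (q μ : ℚ),
    IsRegularImmersionOfCodim i n ∧ (∀ z ∈ Set.range i.base, (n : ℕ∞) ≤ Order.coheight z) ∧
    IsBlochSemiregular i (2 * n) n ∧ subschemeCycle i hi ∈ cyclesOfDim P.X.left n ∧ μ ≠ 0 ∧
    ((q : ℚ) : ℂ) • cupPowTwo h n + w = ((μ : ℚ) : ℂ) • subschemeClass hP (show n + n = 2 * n by omega) ρ i hi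

/-- **(L) for subscheme seeds: Bloch's theorem (arbitrary lci) at the anchor gives the local clause.** Granting
`BlochSemiregularSpreadOfSubscheme (2n) n`, a subscheme seed for `q·hⁿ + w` on `P` yields `WeilAnchorLocalClause n d P h w`
for every `d`: along any family of the clause with global `H`, `W` and chart `e' : P ≅ 𝒳_{s₀}`, the global class
`μ⁻¹·(q·Hⁿ + W)` is fibrewise rational of type `(n,n)` and restricts on the anchor to `[Z]`, so it is algebraic over an
open `U ∋ s₀`, hence so is `q·Hⁿ + W`. [cite: Bloch1972Semiregularity, Thm. (7.4) and Remark (7.5)]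
[cite: BuchweitzFlenner2003, Thm. 5.2] -/
theorem weilAnchorLocalClause_of_blochSpreadOfSubscheme_of_subschemeSeedAt {n : ℕ} (d : ℕ)
    (hB : BlochSemiregularSpreadOfSubscheme (2 * n) n) {P : AbelianVariety ℂ} {h : complexBetti P.X 2}
    {w : complexBetti P.X (2 * n)} (hS : HasBlochSubschemeSeedAt n P h w) : WeilAnchorLocalClause n d P h w := by
  obtain ⟨hP, ρ, Z, i, hi, hZn, q, μ, hreg, hcodim, hsr, hmem, hμ, hclass⟩ := hS
  haveI := hZn
  intro 𝒳 S f hf h𝒳qp hSqp _ hsm _ H W hH hW s₀ e' hH₀ hW₀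
  -- the global classes `B = q·Hⁿ + W` and `B' = μ⁻¹·B`, their fibre restrictions
  set B : complexBetti 𝒳 (2 * n) := ((q : ℚ) : ℂ) • cupPowTwo H n + W with hBdef
  have hres : ∀ s : ComplexPoints S, complexBetti.map (fiberι f s) (2 * n) B =
      ((q : ℚ) : ℂ) • cupPowTwo (complexBetti.map (fiberι f s) 2 H) n + complexBetti.map (fiberι f s) (2 * n) W := by
    intro s
    rw [hBdef, map_add, map_smul, complexBetti_map_cupPowTwo']
  have hBrat : ∀ s : ComplexPoints S, IsRationalClass (complexBetti.map (fiberι f s) (2 * n) B) ∧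
      IsOfHodgeType (2 * n) (fiberOver f s) (2 * n) n n (complexBetti.map (fiberι f s) (2 * n) B) := by
    intro s
    rw [hres]
    exact ⟨(((hH s).1.cupPowTwo n).smul q).add (hW s).1,
      ((isOfHodgeType_cupPowTwo (hf.isSmoothProjective s) (hH s).2 n).smul _).add (hf.isSmoothProjective s) (hW s).2⟩
  set B' : complexBetti 𝒳 (2 * n) := ((μ⁻¹ : ℚ) : ℂ) • B with hB'def
  have hres' : ∀ s : ComplexPoints S, complexBetti.map (fiberι f s) (2 * n) B' =
      ((μ⁻¹ : ℚ) : ℂ) • complexBetti.map (fiberι f s) (2 * n) B := by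
    intro s
    rw [hB'def, map_smul]
  have hB'rat : ∀ s : ComplexPoints S, IsRationalClass (complexBetti.map (fiberι f s) (2 * n) B') ∧
      IsOfHodgeType (2 * n) (fiberOver f s) (2 * n) n n (complexBetti.map (fiberι f s) (2 * n) B') := by
    intro s
    rw [hres']
    exact ⟨(hBrat s).1.smul μ⁻¹, (hBrat s).2.smul _⟩
  -- the anchoring: `e'^* B'_{s₀} = [Z]`
  have hx : complexBetti.map e'.hom (2 * n) (complexBetti.map (fiberι f s₀) (2 * n) B') =
      subschemeClass hP (show n + n = 2 * n by omega) ρ i hi := by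
    rw [hres', map_smul, hres, map_add, map_smul, complexBetti_map_cupPowTwo', hH₀, hW₀, hclass, smul_smul,
      ← Rat.cast_mul, inv_mul_cancel₀ hμ, Rat.cast_one, one_smul]
  -- Bloch's theorem for the lci subscheme `Z`, class level
  obtain ⟨U, hUo, hs₀U, hU⟩ :=
    hB P.X Z i _ 𝒳 S f s₀ e' B' hP n (by omega) ρ hi hreg hcodim hsr hmem rfl hf h𝒳qp hSqp hsm hB'rat hx
  refine ⟨U, q, hUo, hs₀U, fun s hs => ?_⟩
  have halg : ((μ : ℚ) : ℂ) • complexBetti.map (fiberι f s) (2 * n) B' ∈ algebraicClasses (fiberOver f s) n :=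
    Submodule.smul_mem _ _ (hU s hs)
  rw [hres', smul_smul, ← Rat.cast_mul, mul_inv_cancel₀ hμ, Rat.cast_one, one_smul, hres] at halg
  exact halg

/-- **The anchor's component from one SUBSCHEME seed** (`n, d ≥ 1`): `BlochSemiregularSpreadOfSubscheme (2n) n` ∧
`weilFamilyReach_similar` (both refereed named facts) ∧ an anchor with a non-zero rational `(n,n)` Weil class `w` and a
subscheme seed for `q·h_Kⁿ + w` ⟹ the Weil plane of every `√-d`-Weil `2n`-fold with a non-zero `(n,n)` Weil class and
Weil-similar to the anchor is algebraic. [cite: Bloch1972Semiregularity, Thm. (7.4) and Remark (7.5)]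
[cite: Deligne1982HodgeCycles, proof of Thm. 4.8] -/
theorem weilClasses_algebraic_of_similar_subschemeSeed {n d : ℕ} (hn : 1 ≤ n) (hd : 1 ≤ d)
    (hB : BlochSemiregularSpreadOfSubscheme (2 * n) n) (hF : weilFamilyReach_similar)
    (P : AbelianVariety ℂ) (ψ₀ : P ⟶ P) (ι : ProjectiveEmbedding P.X) (a : complexBetti (projectiveSpace ι.n ℂ) 2)
    (w : complexBetti P.X (2 * n)) (hP : P.dim = 2 * n) (hψ : ψ₀ ≫ ψ₀ = -(d • 𝟙 P)) (ha : IsRationalClass a)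
    (ha0 : a ≠ 0) (hwW : w ∈ weilClassesOf P ψ₀ n d) (hwr : IsRationalClass w) (hw0 : w ≠ 0)
    (hwH : IsOfHodgeType (2 * n) P.X (2 * n) n n w)
    (hS : HasBlochSubschemeSeedAt n P
      ((d : ℂ) • complexBetti.map ι.ι 2 a + complexBetti.map ψ₀.hom.hom.hom 2 (complexBetti.map ι.ι 2 a)) w)
    (A : AbelianVariety ℂ) (φ : A ⟶ A) (hA : A.dim = 2 * n) (hφ : φ ≫ φ = -(d • 𝟙 A))
    (hWA : ∃ wA : complexBetti A.X (2 * n),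
      wA ∈ weilClassesOf A φ n d ∧ wA ≠ 0 ∧ IsOfHodgeType (2 * n) A.X (2 * n) n n wA)
    (eA : ProjectiveEmbedding A.X) (aA : complexBetti (projectiveSpace eA.n ℂ) 2) (haA : IsRationalClass aA)
    (haA0 : aA ≠ 0)
    (hsim : IsWeilSimilar n P ψ₀
      ((d : ℂ) • complexBetti.map ι.ι 2 a + complexBetti.map ψ₀.hom.hom.hom 2 (complexBetti.map ι.ι 2 a)) A φ
      ((d : ℂ) • complexBetti.map eA.ι 2 aA + complexBetti.map φ.hom.hom.hom 2 (complexBetti.map eA.ι 2 aA))) :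
    weilClassesOf A φ n d ≤ algebraicClasses A.X n :=
  weilClassesOf_le_algebraicClasses_of_reachSimilar_of_similarAnchor hF hn hd A φ hA hφ hWA
    ⟨eA, aA, P, ψ₀, ι, a, w, haA, haA0, hP, hψ, ha, ha0, hwW, hwr, hw0, hwH,
      weilAnchorLocalClause_of_blochSpreadOfSubscheme_of_subschemeSeedAt d hB hS, hsim⟩

/-- **The split component from one SUBSCHEME seed on a SPLIT anchor** (`n, d ≥ 1`):
`BlochSemiregularSpreadOfSubscheme (2n) n` ∧ `weilFamilyReach_hyperbolic` (both refereed) ∧ a subscheme seed at a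
hyperbolic anchor for a non-zero rational Weil class ⟹ the Weil plane of EVERY split `√-d`-Weil abelian `2n`-fold is
algebraic. [cite: Bloch1972Semiregularity, Thm. (7.4) and Remark (7.5)] [cite: Deligne1982HodgeCycles, proof of Thm. 4.8] -/
theorem weilClasses_algebraic_split_of_hyperbolic_subschemeSeed (n d : ℕ) (hn : 1 ≤ n) (hd : 1 ≤ d)
    (hB : BlochSemiregularSpreadOfSubscheme (2 * n) n) (hF : weilFamilyReach_hyperbolic)
    (P : AbelianVariety ℂ) (ψ₀ : P ⟶ P) (ι : ProjectiveEmbedding P.X) (a : complexBetti (projectiveSpace ι.n ℂ) 2)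
    (w : complexBetti P.X (2 * n)) (hP : P.dim = 2 * n) (hψ : ψ₀ ≫ ψ₀ = -(d • 𝟙 P)) (ha : IsRationalClass a)
    (ha0 : a ≠ 0)
    (hhyp : IsHyperbolicWeilType P ψ₀ n
      ((d : ℂ) • complexBetti.map ι.ι 2 a + complexBetti.map ψ₀.hom.hom.hom 2 (complexBetti.map ι.ι 2 a)))
    (hwW : w ∈ weilClassesOf P ψ₀ n d) (hwr : IsRationalClass w) (hw0 : w ≠ 0)
    (hS : HasBlochSubschemeSeedAt n P
      ((d : ℂ) • complexBetti.map ι.ι 2 a + complexBetti.map ψ₀.hom.hom.hom 2 (complexBetti.map ι.ι 2 a)) w)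
    (A : AbelianVariety ℂ) (φ : A ⟶ A) (hA : A.dim = 2 * n) (hφ : φ ≫ φ = -(d • 𝟙 A))
    (eA : ProjectiveEmbedding A.X) (aA : complexBetti (projectiveSpace eA.n ℂ) 2) (haA : IsRationalClass aA)
    (haA0 : aA ≠ 0)
    (hhypA : IsHyperbolicWeilType A φ n
      ((d : ℂ) • complexBetti.map eA.ι 2 aA + complexBetti.map φ.hom.hom.hom 2 (complexBetti.map eA.ι 2 aA))) :
    weilClassesOf A φ n d ≤ algebraicClasses A.X n :=
  weilClasses_algebraic_hyperbolic_of_localAnchor n d hn hd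
    ((hasLocallyAlgebraicWeilAnchor_iff n d).2
      ⟨P, ψ₀, ι, a, w, hP, hψ, ha, ha0, hhyp, hwW, hwr, hw0,
        weilAnchorLocalClause_of_blochSpreadOfSubscheme_of_subschemeSeedAt d hB hS⟩)
    hF A φ hA hφ eA aA haA haA0 hhypA

end Summit.Ventures.HSemireg

end
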